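import Summits.QuantumFields.YangMills.Theorems.FluctuationComparisonRegPrIntLS2BetaChartReadDescentOnto
import Literature.MathematicalPhysics.QuantumFieldTheory.Balaban1983to89.T4ReflectionConeSharp
import Literature.MathematicalPhysics.QuantumFieldTheory.Balaban1983to89.B16Sect1Backgrounds
import Literature.MathematicalPhysics.QuantumFieldTheory.Balaban1983to89.B14Eq22Determines
import Literature.MathematicalPhysics.QuantumFieldTheory.Balaban1983to89.B7Eq78Linearization
import HarnessLib

/-!
# S2β ∕ GAP♯∘ strata residue, (RINV-curl) bricks (B1)+(B2) — SHARP LOCALITY OF THE k-FOLD (0.4) AVERAGE AND THE EXACT IMAGE OF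
# PURE-GAUGE DIRECTIONS UNDER `DM = DΨ_k(0)` (generic `P : Params`, any `LoopAverage` ∕ `SU(N)`; DEFINITION-FREE)

Cell `ym3-torus` (YM ladder rung R3 = continuum `SU(2)` Yang–Mills on the three-torus — a RUNG: NOT d = 4, NOT infinite volume,
NOT a mass gap, NOT Clay).  Width seat «width 16» `ym3-torus-px16` (gen 21), FREE px helper on crux `stmt-QuantumFields-20520`
(`FluctuationComparisonRegPrIntL`), count-neutral, DEFINITION-FREE (0 `def`, 0 `instance`, 0 `notation`, 0 `sorry`), default heartbeats.

WHY.  MULT♮ of the pairing lane follows from (RINV-curl) «every coarse tangent `v` has a `DM`-preimage with covariant curl `O(N·‖v‖₁)`»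
(✓`…S2BetaMultOfPreimages.multAx_of_preimages`).  The road to (RINV-curl) by GAUGE-FAMILY FACE PREIMAGES (bus 13:44Z): for a coarse bond
`B = ⟨x, μ⟩` and a generator `λ` supported on the `k`-block of `x`, `DM(D_{U₀}λ) = D_V(λ ∘ ι_k)` EXACTLY by the gauge covariance of the iterate —
this is (B2) —, `D_{U₀}λ` splits as the sum of the `2d` FACE SPREADS of the block plus an interior defect, and each face spread is read by
exactly ONE coarse bond by the SHARP locality of the iterate — this is (B1) —; the rest is one sup-norm bound on `DM` ((D2)), the thin-loop
tree bound and the face curl count (separate files).  THIS FILE proves (B1) and (B2) for Bałaban's (0.4) average with ANY small-loop average `ℰ`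
resp. for pub-ymgap N09's chart-read `SU(N)` iterate `Ψ_k(A)(c) = Λ(Ū^k(Θ^B(A)·U₀)(c)·Ū^k(U₀)(c)⁻¹)` (✓p823800's object, verbatim).

WHAT IS PROVED.
* §1 (one step): lit ✓`T4ReflectionConeSharp.avgFun_congr₂` BY NAME — `Ū(c)` depends on `U` only on the bonds with BOTH endpoints in `B(c₋) ∪ B(c₊)`
  (the `Averaging.local_dep` axiom asks agreement on every bond ISSUING from the two blocks; the (0.4) contours never leave them).
* §2 ★★`iter_blockAvg_local_sharp` (B1): in the standing range `k ≤ m + K`, `Ū^k(U)(B)` depends on `U` only on the finest bonds `b` with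
  `blockIter k b₋, blockIter k b₊ ∈ {B₋, B₊}` (lit ✓`B14.Eq22Determines.blockIter`).
* §3 ★★`fderiv_chartRead_iter_apply_eq_zero_of_forall` (B1′): for EVERY `U₀` (no guard: `fderiv` of a non-differentiable map is `0`), every `k ≤ m + K`
  and every chart direction `X` vanishing on that read set, `(DΨ_k(0) X)(B) = 0`.
* §4 `hasDerivAt_of_coe` (subspace-valued curves), `hasDerivAt_coe_conj` ∕ `coe_conj_zero` ∕ `eventually_conj_mem_window` ∕ ★`hasDerivAt_coe_logChart_conj`
  (the one-bond computation `d∕dt|₀ Λ(e^{tΛ₋}·U·e^{−tΛ₊}·U⁻¹) = Λ₋ − UΛ₊U*`, lit ✓`B7Eq78Linearization.hasFDerivAt_mlog_one`), and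
  ★★★`coe_fderiv_chartRead_iter_gaugeTangent` (B2): under the (0.4) guard below `k` (✓p823800 `contDiffAt_chartRead_iter`), for every site field
  `λ : T_η → 𝔰𝔲(N)` and every chart direction `Ȧ` with `↑(Ȧ b) = λ(b₋) − U₀(b)λ(b₊)U₀(b)*`:
    `↑((DΨ_k(0) Ȧ)(c)) = λ(ι_k c₋) − Ū^k(U₀)(c)·λ(ι_k c₊)·Ū^k(U₀)(c)*`   (`ι_k = embIter k`),
  by differentiating `Ψ_k` along the charted gauge family `U₀^{exp(tλ)}` (lit ✓`B16Sect1Backgrounds.iter_gaugeAct`: `Ū^k(U^u) = (Ū^k U)^{u ∘ ι_k}`).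

HONEST SCOPE.  Two structural facts (locality, covariance) about the tree's own averaging, read at the derivative; nothing of Bałaban's analysis is
asserted; (D2), the thin-loop bound, the face curl count, (RINV-curl), MULT♮, AVG₂♭-ax, «CRIT-ax», (D-ax), GAP♯∘ (`stub_uniformFibreGapOrbit`; registry
`Lines/semiclassical_s2beta.lean` 3732b7df UNTOUCHED), the five registered stubs, S2β, crux 20520, 19936, 19200 and `YM3TorusSU2` are NOT proved; no
registered stub is closed; the Yang–Mills mass gap is NOT proved.  Sorry-free, axioms standard.

References: T. Bałaban, CMP **98** (1985) 17–51 [Balaban1985Averaging] ((8), (11)–(13) pp.18–19; (43) p.25); CMP **109** (1987) 249–301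
[Balaban1987RG1] ((0.4), (0.6), (0.11) p.253); S. Helgason, *Differential Geometry, Lie Groups, and Symmetric Spaces* (AMS 2001) [Helgason2000]
(Ch. I §1 Thm 1.14 p.96, bookkeeping).
-/

set_option autoImplicit false

noncomputable section

open scoped Matrix.Norms.L2Operator Topology
open Filter Set Function

namespace Summit.QuantumFields.YangMills.Theorems.FluctuationComparisonRegPrIntLS2BetaChartReadGaugeAndLocality

open Literature.MathematicalPhysics.QuantumFieldTheory.Balaban1983to89
open Literature.MathematicalPhysics.QuantumFieldTheory.Balaban1983to89.T4Continuum
open Literature.MathematicalPhysics.QuantumFieldTheory.Balaban1983to89.AveragingRT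
open Literature.MathematicalPhysics.QuantumFieldTheory.Balaban1983to89.BlockAveraging
open Literature.MathematicalPhysics.QuantumFieldTheory.Balaban1983to89.B14.Eq22Determines (blockIter blockIter_zero blockIter_succ)
open Literature.MathematicalPhysics.QuantumFieldTheory.Balaban1983to89.B15DeterminingSets (embIter)

/-! ## §1 (B1, one step) Sharp locality of the (0.4) average is ALREADY in the tree: lit ✓`T4ReflectionConeSharp.avgFun_congr₂` — `Ū(c)` depends on `U`
only on the bonds with BOTH endpoints in `B(c₋) ∪ B(c₊)`; it is used BY NAME below. -/

/-! ## §2 (B1, k steps) Sharp locality of the iterate: `Ū^k(U)(B)` reads only the finest bonds with both endpoints in `B^k(B₋) ∪ B^k(B₊)` -/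

section Iterate

variable {P : Params} {G : Type*} [GaugeGroup G]

/-- ★★ **(B1): SHARP LOCALITY OF THE k-FOLD (0.4) AVERAGE** (standing range `k ≤ m + K`): if `U` and `U′` agree on every finest bond whose two endpoints have their
`k`-fold block labels (lit ✓`B14.Eq22Determines.blockIter k`) in `{B₋, B₊}`, then `Ū^k(U)(B) = Ū^k(U′)(B)` — induction on `k` over the one-step sharp locality.
[cite: Balaban1987RG1, (0.4), (0.11) p.253; Balaban1985Averaging, (43) p.25, p.19 (locality)] -/
theorem iter_blockAvg_local_sharp (ℰ : LoopAverage G) : ∀ (k : ℕ), k ≤ P.m + P.K → ∀ (U U' : GaugeField P 0 G) (B : PBond P k),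
    (∀ b : PBond P 0, (blockIter k b.src = B.src ∨ blockIter k b.src = B.tgt) → (blockIter k b.tgt = B.src ∨ blockIter k b.tgt = B.tgt) → U b = U' b) →
    Averaging.iter (fun i => blockAvg (P := P) (j := i) ℰ) k U B = Averaging.iter (fun i => blockAvg (P := P) (j := i) ℰ) k U' B
  | 0, _, U, U', B, h => h B (Or.inl rfl) (Or.inr rfl)
  | k + 1, hk, U, U', B, h => by
    show avgFun ℰ (Averaging.iter (fun i => blockAvg (P := P) (j := i) ℰ) k U) B =
      avgFun ℰ (Averaging.iter (fun i => blockAvg (P := P) (j := i) ℰ) k U') B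
    refine T4ReflectionConeSharp.avgFun_congr₂ ℰ hk _ _ B fun b₁ hs ht => ?_
    refine iter_blockAvg_local_sharp ℰ k (Nat.le_of_succ_le hk) U U' b₁ fun b hbs hbt => h b ?_ ?_
    · rw [blockIter_succ]
      rcases hbs with h1 | h1 <;> rw [h1]
      · exact hs
      · exact ht
    · rw [blockIter_succ]
      rcases hbt with h1 | h1 <;> rw [h1]
      · exact hs
      · exact ht

end Iterate

/-! ## §3 (B1, derivative form) Directions supported off the read set of `B` are killed by the `B`-component of `DM = DΨ_k(0)` -/

section Derivative

open Literature.MathematicalPhysics.QuantumFieldTheory.Balaban1983to89.HaarExponentialChart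
open Literature.MathematicalPhysics.QuantumFieldTheory.Balaban1983to89.HaarExponentialChart.IsChartRep
open Literature.MathematicalPhysics.QuantumFieldTheory.Balaban1983to89.ExpMeanLog (expMeanLogSU deltaSU)
open Literature.MathematicalPhysics.QuantumFieldTheory.Balaban1983to89.Node00
open Literature.MathematicalPhysics.QuantumLattice (fundamentalRep fundamentalRep_apply)
open MatrixLog (mlog)
open Summit.QuantumFields.YangMills.BalabanUVNodes.N09ChartReadAveragingSmooth
open Summit.QuantumFields.YangMills.BalabanUVNodes.N09AveragingOpenAtSmallFields (logChart_one)

variable {P : Params} {N : ℕ} [NeZero N]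

/-- ★★ **(B1′): `(DΨ_k(0) X)(B) = 0` WHENEVER `X` VANISHES ON THE READ SET OF `B`** — the finest bonds with both endpoints' `k`-block labels in `{B₋, B₊}`.  No hypothesis on
`U₀`: along the ray `t ↦ t·X` the `B`-component of the charted iterate is constant by ✓`iter_blockAvg_local_sharp` (`Θ(0) = 1`), so its derivative — the `B`-component of
`DΨ_k(0) X` when `Ψ_k` is differentiable at `0` (✓N09 `hasDerivAt_along_ray`), and `0` by convention otherwise — vanishes. [cite: Balaban1987RG1, (0.4), (0.11) p.253; Balaban1985Averaging, p.19 (locality)] -/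
theorem fderiv_chartRead_iter_apply_eq_zero_of_forall (U₀ : GaugeField P 0 (SU N)) {k : ℕ} (hk : k ≤ P.m + P.K) (B : PBond P k)
    (X : PBond P 0 → (specialUnitaryLogChart (Fin N)).lie)
    (hX : ∀ b : PBond P 0, (B14.Eq22Determines.blockIter k b.src = B.src ∨ B14.Eq22Determines.blockIter k b.src = B.tgt) →
      (B14.Eq22Determines.blockIter k b.tgt = B.src ∨ B14.Eq22Determines.blockIter k b.tgt = B.tgt) → X b = 0) :
    fderiv ℝ (fun (A : PBond P 0 → (specialUnitaryLogChart (Fin N)).lie) (c : PBond P k) =>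
        (isChartRep_specialUnitaryGroup (n := Fin N)).logChart
          (Averaging.iter (fun i => blockAvg (P := P) (j := i) (expMeanLogSU (n := Fin N))) k
              (fun b => (isChartRep_specialUnitaryGroup (n := Fin N)).expChart (A b) * U₀ b) c *
            (Averaging.iter (fun i => blockAvg (P := P) (j := i) (expMeanLogSU (n := Fin N))) k U₀ c)⁻¹)) 0 X B = 0 := by
  set Ψ : (PBond P 0 → (specialUnitaryLogChart (Fin N)).lie) → (PBond P k → (specialUnitaryLogChart (Fin N)).lie) :=
    fun A c => (isChartRep_specialUnitaryGroup (n := Fin N)).logChart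
      (Averaging.iter (fun i => blockAvg (P := P) (j := i) (expMeanLogSU (n := Fin N))) k
          (fun b => (isChartRep_specialUnitaryGroup (n := Fin N)).expChart (A b) * U₀ b) c *
        (Averaging.iter (fun i => blockAvg (P := P) (j := i) (expMeanLogSU (n := Fin N))) k U₀ c)⁻¹) with hΨ
  -- along the ray the `B`-component is constant (sharp locality: the two fields agree on the read set of `B`)
  have hconst : ∀ t : ℝ, Ψ (t • X) B = Ψ 0 B := by
    intro t
    have hI : Averaging.iter (fun i => blockAvg (P := P) (j := i) (expMeanLogSU (n := Fin N))) k
          (fun b => (isChartRep_specialUnitaryGroup (n := Fin N)).expChart ((t • X) b) * U₀ b) B =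
        Averaging.iter (fun i => blockAvg (P := P) (j := i) (expMeanLogSU (n := Fin N))) k
          (fun b => (isChartRep_specialUnitaryGroup (n := Fin N)).expChart ((0 : PBond P 0 → (specialUnitaryLogChart (Fin N)).lie) b) * U₀ b) B :=
      iter_blockAvg_local_sharp (expMeanLogSU (n := Fin N)) k hk _ _ B fun b hs ht => by
        simp only [Pi.smul_apply, Pi.zero_apply, hX b hs ht, smul_zero]
    simp only [hΨ]
    rw [hI]
  by_cases hd : DifferentiableAt ℝ Ψ 0
  · have hray : HasDerivAt (fun t : ℝ => Ψ (t • X) B) (fderiv ℝ Ψ 0 X B) 0 := by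
      have h := hasDerivAt_along_ray (F := PBond P k → (specialUnitaryLogChart (Fin N)).lie) hd X
      exact (hasDerivAt_pi.1 h) B
    have hc : HasDerivAt (fun t : ℝ => Ψ (t • X) B) 0 0 := by
      have : (fun t : ℝ => Ψ (t • X) B) = fun _ => Ψ 0 B := funext hconst
      rw [this]; exact hasDerivAt_const 0 _
    exact hray.unique hc
  · rw [fderiv_zero_of_not_differentiableAt hd]; rfl

end Derivative

/-! ## §4 (B2) Pure-gauge directions: `DΨ_k(0)(D_{U₀}λ) = D_{Ū^k U₀}(λ ∘ embIter k)` EXACTLY (gauge covariance of the iterate) -/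

section Gauge

open Literature.MathematicalPhysics.QuantumFieldTheory.Balaban1983to89.HaarExponentialChart
open Literature.MathematicalPhysics.QuantumFieldTheory.Balaban1983to89.HaarExponentialChart.IsChartRep
open Literature.MathematicalPhysics.QuantumFieldTheory.Balaban1983to89.ExpMeanLog (expMeanLogSU deltaSU)
open Literature.MathematicalPhysics.QuantumFieldTheory.Balaban1983to89.Node00
open Literature.MathematicalPhysics.QuantumLattice (fundamentalRep fundamentalRep_apply)
open MatrixLog (mlog)
open Summit.QuantumFields.YangMills.BalabanUVNodes.N09ChartReadAveragingSmooth
open Summit.QuantumFields.YangMills.BalabanUVNodes.N09AveragingOpenAtSmallFields (logChart_one)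

open Summit.QuantumFields.YangMills.Theorems.FluctuationComparisonRegPrIntLS2BetaChartReadDescentOnto (contDiffAt_chartRead_iter)

variable {N : ℕ} [NeZero N]

/-- In an ambient normed space, a curve valued in a subspace has derivative `v` as soon as its coercion has derivative `↑v` (norms agree). [folklore] -/
theorem hasDerivAt_of_coe {F : Type*} [NormedAddCommGroup F] [NormedSpace ℝ F] (p : Submodule ℝ F) {f : ℝ → p} {v : p} {a : ℝ}
    (h : HasDerivAt (fun t => (f t : F)) (v : F) a) : HasDerivAt f v a := by
  rw [hasDerivAt_iff_isLittleO] at h ⊢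
  refine Asymptotics.IsLittleO.of_norm_left ?_
  refine (h.norm_left).congr_left fun t => ?_
  rw [← Submodule.coe_sub, ← Submodule.coe_smul, ← Submodule.coe_sub, Submodule.coe_norm]

/-- The matrix of the conjugated one-parameter family `e^{tΛ₋}·U·e^{−tΛ₊}·U⁻¹` and its derivative `Λ₋ − U Λ₊ U*` at `t = 0`. [cite: Balaban1985Averaging, (8) p.18 (bookkeeping)] -/
theorem hasDerivAt_coe_conj (U : SU N) (Xs Xt : (specialUnitaryLogChart (Fin N)).lie) :
    HasDerivAt (fun t : ℝ => (((isChartRep_specialUnitaryGroup (n := Fin N)).expChart (t • Xs) * U *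
        ((isChartRep_specialUnitaryGroup (n := Fin N)).expChart (t • Xt))⁻¹ * U⁻¹ : SU N) : Matrix (Fin N) (Fin N) ℂ))
      ((Xs : Matrix (Fin N) (Fin N) ℂ) - (U : Matrix (Fin N) (Fin N) ℂ) * (Xt : Matrix (Fin N) (Fin N) ℂ) * star (U : Matrix (Fin N) (Fin N) ℂ)) 0 := by
  have key : ∀ t : ℝ, (((isChartRep_specialUnitaryGroup (n := Fin N)).expChart (t • Xs) * U *
      ((isChartRep_specialUnitaryGroup (n := Fin N)).expChart (t • Xt))⁻¹ * U⁻¹ : SU N) : Matrix (Fin N) (Fin N) ℂ) =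
      NormedSpace.exp (t • (Xs : Matrix (Fin N) (Fin N) ℂ)) * (U : Matrix (Fin N) (Fin N) ℂ) *
        NormedSpace.exp (t • (-(Xt : Matrix (Fin N) (Fin N) ℂ))) * star (U : Matrix (Fin N) (Fin N) ℂ) := by
    intro t
    rw [← (isChartRep_specialUnitaryGroup (n := Fin N)).expChart_neg, Submonoid.coe_mul, Submonoid.coe_mul, Submonoid.coe_mul, coe_inv_SU,
      BalabanUVNodes.N09ChartReadAveragingSmooth.coe_expChart, BalabanUVNodes.N09ChartReadAveragingSmooth.coe_expChart,
      Submodule.coe_neg, Submodule.coe_smul, Submodule.coe_smul, smul_neg]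
  have h1 := hasDerivAt_exp_smul_const (𝕂 := ℝ) (Xs : Matrix (Fin N) (Fin N) ℂ) (0 : ℝ)
  have h2 := hasDerivAt_exp_smul_const (𝕂 := ℝ) (-(Xt : Matrix (Fin N) (Fin N) ℂ)) (0 : ℝ)
  rw [zero_smul, NormedSpace.exp_zero, one_mul] at h1 h2
  have h := ((h1.mul_const (U : Matrix (Fin N) (Fin N) ℂ)).mul h2).mul_const (star (U : Matrix (Fin N) (Fin N) ℂ))
  simp only [zero_smul, NormedSpace.exp_zero, one_mul, mul_one] at h
  refine (h.congr_deriv ?_).congr_of_eventuallyEq (Eventually.of_forall key)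
  rw [add_mul, mul_assoc (Xs : Matrix (Fin N) (Fin N) ℂ), coe_mul_star_coe_SU, mul_one, mul_neg, neg_mul, ← sub_eq_add_neg]

/-- At `t = 0` the conjugated family is `1`. [cite: Balaban1985Averaging, (8) p.18 (bookkeeping)] -/
theorem coe_conj_zero (U : SU N) (Xs Xt : (specialUnitaryLogChart (Fin N)).lie) :
    (((isChartRep_specialUnitaryGroup (n := Fin N)).expChart ((0 : ℝ) • Xs) * U *
        ((isChartRep_specialUnitaryGroup (n := Fin N)).expChart ((0 : ℝ) • Xt))⁻¹ * U⁻¹ : SU N) : Matrix (Fin N) (Fin N) ℂ) = 1 := by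
  rw [zero_smul, zero_smul, (isChartRep_specialUnitaryGroup (n := Fin N)).expChart_zero, one_mul, inv_one, mul_one, mul_inv_cancel, OneMemClass.coe_one]

/-- Near `t = 0` the conjugated family is inside the log window. [cite: Helgason2000, Ch. I §1 Thm. 1.14 (13) p. 96 (bookkeeping)] -/
theorem eventually_conj_mem_window (U : SU N) (Xs Xt : (specialUnitaryLogChart (Fin N)).lie) :
    ∀ᶠ t : ℝ in 𝓝 0, ‖(((isChartRep_specialUnitaryGroup (n := Fin N)).expChart (t • Xs) * U *
        ((isChartRep_specialUnitaryGroup (n := Fin N)).expChart (t • Xt))⁻¹ * U⁻¹ : SU N) : Matrix (Fin N) (Fin N) ℂ) - 1‖ <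
      innerRadius (specialUnitaryLogChart (Fin N)) := by
  have h1 := (hasDerivAt_coe_conj (N := N) U Xs Xt).continuousAt
  have hc : ContinuousAt (fun t : ℝ => ‖(((isChartRep_specialUnitaryGroup (n := Fin N)).expChart (t • Xs) * U *
      ((isChartRep_specialUnitaryGroup (n := Fin N)).expChart (t • Xt))⁻¹ * U⁻¹ : SU N) : Matrix (Fin N) (Fin N) ℂ) - 1‖) 0 :=
    (h1.sub continuousAt_const).norm
  refine hc.eventually (isOpen_Iio.mem_nhds ?_)
  simp only [mem_Iio]
  rw [coe_conj_zero, sub_self, norm_zero]; exact innerRadius_pos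

/-- ★ The one-bond computation behind gauge covariance: for `U ∈ SU(N)` and `Λ₋, Λ₊ ∈ 𝔰𝔲(N)`, the chart reading of the conjugated family
`t ↦ Λ(e^{tΛ₋}·U·e^{−tΛ₊}·U⁻¹)` has derivative `Λ₋ − U Λ₊ U*` at `t = 0` (in the matrix algebra; `D log(1) = id`, lit ✓`B7Eq78Linearization.hasFDerivAt_mlog_one`). [cite: Balaban1985Averaging, (8), (11) p.18-19 (bookkeeping)] -/
theorem hasDerivAt_coe_logChart_conj (U : SU N) (Xs Xt : (specialUnitaryLogChart (Fin N)).lie) :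
    HasDerivAt (fun t : ℝ => (((isChartRep_specialUnitaryGroup (n := Fin N)).logChart
        ((isChartRep_specialUnitaryGroup (n := Fin N)).expChart (t • Xs) * U * ((isChartRep_specialUnitaryGroup (n := Fin N)).expChart (t • Xt))⁻¹ * U⁻¹) :
          (specialUnitaryLogChart (Fin N)).lie) : Matrix (Fin N) (Fin N) ℂ))
      ((Xs : Matrix (Fin N) (Fin N) ℂ) - (U : Matrix (Fin N) (Fin N) ℂ) * (Xt : Matrix (Fin N) (Fin N) ℂ) * star (U : Matrix (Fin N) (Fin N) ℂ)) 0 := by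
  have hg := hasDerivAt_coe_conj (N := N) U Xs Xt
  have heq : (fun t : ℝ => (((isChartRep_specialUnitaryGroup (n := Fin N)).logChart
        ((isChartRep_specialUnitaryGroup (n := Fin N)).expChart (t • Xs) * U * ((isChartRep_specialUnitaryGroup (n := Fin N)).expChart (t • Xt))⁻¹ * U⁻¹) :
          (specialUnitaryLogChart (Fin N)).lie) : Matrix (Fin N) (Fin N) ℂ)) =ᶠ[𝓝 0] fun t =>
      mlog (((isChartRep_specialUnitaryGroup (n := Fin N)).expChart (t • Xs) * U *
        ((isChartRep_specialUnitaryGroup (n := Fin N)).expChart (t • Xt))⁻¹ * U⁻¹ : SU N) : Matrix (Fin N) (Fin N) ℂ) := by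
    filter_upwards [eventually_conj_mem_window (N := N) U Xs Xt] with t ht
    rw [(isChartRep_specialUnitaryGroup (n := Fin N)).coe_logChart (by rwa [fundamentalRep_apply]), fundamentalRep_apply]
  have hlog := (B7Eq78Linearization.hasFDerivAt_mlog_one (𝔸 := Matrix (Fin N) (Fin N) ℂ)).restrictScalars ℝ
  have h := hlog.comp_hasDerivAt_of_eq (0 : ℝ) hg (coe_conj_zero (N := N) U Xs Xt).symm
  refine HasDerivAt.congr_of_eventuallyEq ?_ heq
  simpa [Function.comp_def] using h

variable {P : Params}

/-- ★★★ **(B2): THE IMAGE OF A PURE-GAUGE DIRECTION UNDER `DM = DΨ_k(0)` IS THE COARSE PURE-GAUGE DIRECTION OF THE RESTRICTED GENERATOR — EXACTLY.**  For every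
`U₀` at which the `k`-step chart-read average `Ψ_k` is differentiable at `0` (standing range `k ≤ m + K`), every site field `λ : T_η → 𝔰𝔲(N)`, and every chart direction `Ȧ`
reading the infinitesimal gauge transformation `(D_{U₀}λ)(b) = λ(b₋) − U₀(b)λ(b₊)U₀(b)*`:
  `↑((DΨ_k(0) Ȧ)(c)) = λ(ι_k c₋) − V(c)·λ(ι_k c₊)·V(c)*`,  `V = Ū^k(U₀)`,  `ι_k = embIter k`
— the derivative at `t = 0` of `Ψ_k` along the charted gauge family `U₀^{exp(tλ)}`, which by the covariance of the iterate (lit ✓`B16Sect1Backgrounds.iter_gaugeAct`) reads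
`Λ(g_t(ι_k c₋)·V(c)·g_t(ι_k c₊)⁻¹·V(c)⁻¹)`. [cite: Balaban1985Averaging, (11)-(13) p.19; Balaban1987RG1, (0.6), (0.11) p.253] -/
theorem coe_fderiv_chartRead_iter_gaugeTangent (U₀ : GaugeField P 0 (SU N)) {k : ℕ} (hk : k ≤ P.m + P.K)
    (hsb : SmallBelow (fun i => blockAvg (P := P) (j := i) (expMeanLogSU (n := Fin N))) k U₀)
    (lam : Site P 0 → (specialUnitaryLogChart (Fin N)).lie) (Adot : PBond P 0 → (specialUnitaryLogChart (Fin N)).lie)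
    (hAdot : ∀ b : PBond P 0, (Adot b : Matrix (Fin N) (Fin N) ℂ) =
      (lam b.src : Matrix (Fin N) (Fin N) ℂ) - (U₀ b : Matrix (Fin N) (Fin N) ℂ) * (lam b.tgt : Matrix (Fin N) (Fin N) ℂ) * star (U₀ b : Matrix (Fin N) (Fin N) ℂ))
    (c : PBond P k) :
    ((fderiv ℝ (fun (A : PBond P 0 → (specialUnitaryLogChart (Fin N)).lie) (c : PBond P k) =>
        (isChartRep_specialUnitaryGroup (n := Fin N)).logChart
          (Averaging.iter (fun i => blockAvg (P := P) (j := i) (expMeanLogSU (n := Fin N))) k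
              (fun b => (isChartRep_specialUnitaryGroup (n := Fin N)).expChart (A b) * U₀ b) c *
            (Averaging.iter (fun i => blockAvg (P := P) (j := i) (expMeanLogSU (n := Fin N))) k U₀ c)⁻¹)) 0 Adot c :
        (specialUnitaryLogChart (Fin N)).lie) : Matrix (Fin N) (Fin N) ℂ) =
      (lam (embIter k c.src) : Matrix (Fin N) (Fin N) ℂ) -
        (Averaging.iter (fun i => blockAvg (P := P) (j := i) (expMeanLogSU (n := Fin N))) k U₀ c : Matrix (Fin N) (Fin N) ℂ) *
          (lam (embIter k c.tgt) : Matrix (Fin N) (Fin N) ℂ) *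
          star (Averaging.iter (fun i => blockAvg (P := P) (j := i) (expMeanLogSU (n := Fin N))) k U₀ c : Matrix (Fin N) (Fin N) ℂ) := by
  set Ψ : (PBond P 0 → (specialUnitaryLogChart (Fin N)).lie) → (PBond P k → (specialUnitaryLogChart (Fin N)).lie) :=
    fun A c => (isChartRep_specialUnitaryGroup (n := Fin N)).logChart
      (Averaging.iter (fun i => blockAvg (P := P) (j := i) (expMeanLogSU (n := Fin N))) k
          (fun b => (isChartRep_specialUnitaryGroup (n := Fin N)).expChart (A b) * U₀ b) c *
        (Averaging.iter (fun i => blockAvg (P := P) (j := i) (expMeanLogSU (n := Fin N))) k U₀ c)⁻¹) with hΨdef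
  have hF := ((contDiffAt_chartRead_iter (P := P) (N := N) U₀ k hsb).differentiableAt (by simp)).hasFDerivAt
  -- the gauge family `g_t = exp(tλ)` and the chart reading `A t` of `U₀^{g_t}` relative to `U₀`
  obtain ⟨g, hg⟩ : ∃ g : ℝ → GaugeTransf P 0 (SU N), g = fun t z => (isChartRep_specialUnitaryGroup (n := Fin N)).expChart (t • lam z) := ⟨_, rfl⟩
  obtain ⟨A, hA⟩ : ∃ A : ℝ → (PBond P 0 → (specialUnitaryLogChart (Fin N)).lie),
      A = fun t b => (isChartRep_specialUnitaryGroup (n := Fin N)).logChart (g t b.src * U₀ b * (g t b.tgt)⁻¹ * (U₀ b)⁻¹) := ⟨_, rfl⟩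
  -- (1) `A 0 = 0` and `A` has derivative `Ȧ` at `0` (bondwise: the one-bond computation, read in `𝔰𝔲(N)` through the ambient matrices)
  have hA0 : A 0 = 0 := by
    rw [hA]; funext b
    simp only [hg, zero_smul, (isChartRep_specialUnitaryGroup (n := Fin N)).expChart_zero, one_mul, inv_one, mul_one, mul_inv_cancel, Pi.zero_apply]
    exact logChart_one
  have hdA : HasDerivAt A Adot 0 := by
    refine hasDerivAt_pi.2 fun b => hasDerivAt_of_coe _ ?_
    have h := hasDerivAt_coe_logChart_conj (N := N) (U₀ b) (lam b.src) (lam b.tgt)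
    rw [← hAdot b] at h
    simp only [hA, hg]
    exact h
  -- (2) near `t = 0`, `Θ^B(A t)·U₀ = U₀^{g t}` bondwise (`Θ ∘ Λ = id` on the log window)
  have hwin : ∀ᶠ t : ℝ in 𝓝 0, ∀ b : PBond P 0,
      (isChartRep_specialUnitaryGroup (n := Fin N)).expChart (A t b) * U₀ b = GaugeField.gaugeAct (g t) U₀ b := by
    refine eventually_all.2 fun b => ?_
    filter_upwards [eventually_conj_mem_window (N := N) (U₀ b) (lam b.src) (lam b.tgt)] with t ht
    simp only [hA, hg, GaugeField.gaugeAct]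
    rw [(isChartRep_specialUnitaryGroup (n := Fin N)).expChart_logChart (by rwa [fundamentalRep_apply]), inv_mul_cancel_right]
  -- (3) hence near `t = 0`, `Ψ (A t) c = Λ(g_t(ι c₋)·V c·g_t(ι c₊)⁻¹·(V c)⁻¹)` by the covariance of the iterate
  have hΨA : (fun t : ℝ => ((Ψ (A t) c : (specialUnitaryLogChart (Fin N)).lie) : Matrix (Fin N) (Fin N) ℂ)) =ᶠ[𝓝 0] fun t =>
      (((isChartRep_specialUnitaryGroup (n := Fin N)).logChart
        ((isChartRep_specialUnitaryGroup (n := Fin N)).expChart (t • lam (embIter k c.src)) *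
            Averaging.iter (fun i => blockAvg (P := P) (j := i) (expMeanLogSU (n := Fin N))) k U₀ c *
          ((isChartRep_specialUnitaryGroup (n := Fin N)).expChart (t • lam (embIter k c.tgt)))⁻¹ *
          (Averaging.iter (fun i => blockAvg (P := P) (j := i) (expMeanLogSU (n := Fin N))) k U₀ c)⁻¹) :
            (specialUnitaryLogChart (Fin N)).lie) : Matrix (Fin N) (Fin N) ℂ) := by
    filter_upwards [hwin] with t ht
    have hfield : (fun b => (isChartRep_specialUnitaryGroup (n := Fin N)).expChart (A t b) * U₀ b) = GaugeField.gaugeAct (g t) U₀ := funext ht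
    simp only [hΨdef]
    rw [hfield, B16Sect1Backgrounds.iter_gaugeAct _ (g t) U₀ k hk]
    simp only [hg, GaugeField.gaugeAct, B16Sect1Backgrounds.toMS]
  -- (4) differentiate both readings at `t = 0` and compare
  have hleft : HasDerivAt (fun t : ℝ => ((Ψ (A t) c : (specialUnitaryLogChart (Fin N)).lie) : Matrix (Fin N) (Fin N) ℂ))
      (((fderiv ℝ Ψ 0 Adot) c : (specialUnitaryLogChart (Fin N)).lie) : Matrix (Fin N) (Fin N) ℂ) 0 := by
    have h1 := hF.comp_hasDerivAt_of_eq (0 : ℝ) hdA hA0.symm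
    have h2 := (hasDerivAt_pi.1 h1) c
    exact ((specialUnitaryLogChart (Fin N)).lie.subtypeL.hasFDerivAt.comp_hasDerivAt (0 : ℝ) h2)
  have hright := hasDerivAt_coe_logChart_conj (N := N)
    (Averaging.iter (fun i => blockAvg (P := P) (j := i) (expMeanLogSU (n := Fin N))) k U₀ c) (lam (embIter k c.src)) (lam (embIter k c.tgt))
  have h := (hleft.congr_of_eventuallyEq hΨA.symm).unique hright
  simpa using h

end Gauge

end Summit.QuantumFields.YangMills.Theorems.FluctuationComparisonRegPrIntLS2BetaChartReadGaugeAndLocality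

end
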